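import Literature.GroupTheory.CombinatorialGroupTheory.QuadraticWordsVertexDefs
import Literature.GroupTheory.CombinatorialGroupTheory.PermutationCycleSurgery
import HarnessLib

/-!
# Systems of quadratic words: the vertex permutation of several faces, concatenation and deletion

Topic `Literature/GroupTheory/CombinatorialGroupTheory`; continues `QuadraticWordsVertexDefs.lean`.
A finite 2-complex all of whose faces are polygons is recorded as a SYSTEM of words: a list of
faces `Fs : List (List (ι × Bool))` over the edge symbols `ι`, the letters of all faces being
pairwise distinct.  Its vertices are the cycles of the **vertex permutation of the system**

  `sysPerm Fs = (∏_{F ∈ Fs} formPerm F) ∘ bar`,   `x ↦ (successor, in its face, of x̄)`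

(ZVC 3.1.2: the star of a vertex), which on a one-face system is `vertexPerm`.  Two operations
and their effect on the vertex permutation:

* `sysPerm_append_cons` — CONCATENATING two faces `Φ`, `r` into one face `Φ ++ r` multiplies the
  vertex permutation by the transposition of `Φ̄ₗ` and `r̄ₗ` (partners of the two last letters);
* `exists_firstReturn_formPerm_filter`, `sysPerm_filter_firstReturn` — DELETING a set `D` of
  letters closed under `bar` from all faces replaces the vertex permutation `σ` by the FIRST
  RETURN to the remaining letters of `σ ∘ s_D`, where `s_D` is `bar` on `D` and the identity
  elsewhere (contracting the deleted edges, ZVC 3.1.6 (b)); with `sameCycle_of_firstReturn` of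
  `PermutationCycleSurgery.lean` this controls the vertices after a deletion.

Gluing two faces along a common edge `y` (Φ = A y, r = C ȳ ↦ A C) is "concatenate, then delete
`{y, ȳ}`", and `swap ȳ y * swap y ȳ = 1`, so the glued system's vertex permutation is the first
return of the old one: gluing does not change the vertices (`sysPerm_glue_firstReturn`).

## References

* H. Zieschang, E. Vogt, H.-D. Coldewey, *Surfaces and Planar Discontinuous Groups*, LNM 835,
  Springer 1980, 3.1.2, 3.1.5–3.1.6. [ZieschangVogtColdewey1980]
-/

namespace Literature.GroupTheory.CombinatorialGroupTheory

open List Equiv Equiv.Perm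

variable {ι : Type*} [DecidableEq ι]

/-! ### The vertex permutation of a system of faces -/

/-- **The vertex permutation of a system of faces**: the product of the successor permutations
of the faces, precomposed with the partner involution. [cite: ZieschangVogtColdewey1980, 3.1.2] -/
def sysPerm (Fs : List (List (ι × Bool))) : Perm (ι × Bool) := (Fs.map List.formPerm).prod * barPerm

/-- `sysPerm Fs x = (∏ formPerm F) x̄`. [cite: ZieschangVogtColdewey1980, 3.1.2] -/
theorem sysPerm_apply (Fs : List (List (ι × Bool))) (x : ι × Bool) :
    sysPerm Fs x = (Fs.map List.formPerm).prod (bar x) := rfl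

/-- A one-face system has the vertex permutation of its face. [cite: ZieschangVogtColdewey1980, 3.1.2] -/
theorem sysPerm_singleton (W : List (ι × Bool)) : sysPerm [W] = vertexPerm W := by
  simp [sysPerm, vertexPerm]

/-- The successor of the last letter is the first letter. [cite: ZieschangVogtColdewey1980, 3.1.1] -/
theorem formPerm_apply_getLast' {α : Type*} [DecidableEq α] (l : List α) (h : l ≠ []) :
    l.formPerm (l.getLast h) = l.head h := by
  obtain ⟨a, L, rfl⟩ := exists_cons_of_ne_nil h
  exact formPerm_apply_getLast a L

/-- A letter in no face is fixed by the product of the successor permutations.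
[cite: ZieschangVogtColdewey1980, 3.1.2] -/
theorem prod_formPerm_apply_of_not_mem {Fs : List (List (ι × Bool))} {x : ι × Bool}
    (hx : x ∉ Fs.flatten) : (Fs.map List.formPerm).prod x = x := by
  induction Fs with
  | nil => rfl
  | cons G Gs ih =>
    rw [map_cons, prod_cons, Perm.mul_apply, ih fun h => hx (by simp [h]),
      formPerm_apply_of_notMem fun h => hx (by simp [h])]

/-- **The successor in a system is the successor in the face**: for pairwise distinct letters,
`(∏ formPerm F) x = formPerm F x` for the face `F` containing `x`. [cite: ZieschangVogtColdewey1980, 3.1.2] -/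
theorem prod_formPerm_apply_of_mem {Fs : List (List (ι × Bool))} (hd : Fs.flatten.Nodup)
    {F : List (ι × Bool)} (hF : F ∈ Fs) {x : ι × Bool} (hx : x ∈ F) :
    (Fs.map List.formPerm).prod x = F.formPerm x := by
  induction Fs with
  | nil => simp at hF
  | cons G Gs ih =>
    rw [flatten_cons] at hd
    rw [map_cons, prod_cons, Perm.mul_apply]
    rcases mem_cons.1 hF with rfl | hF'
    · rw [prod_formPerm_apply_of_not_mem fun h => (disjoint_of_nodup_append hd) hx h]
    · have hx' : x ∈ Gs.flatten := mem_flatten.2 ⟨F, hF', hx⟩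
      rw [ih (nodup_append.1 hd).2.1 hF']
      exact formPerm_apply_of_notMem fun h =>
        (disjoint_of_nodup_append hd) h (mem_flatten.2 ⟨F, hF', formPerm_apply_mem_of_mem hx⟩)

/-- `sysPerm Fs x = formPerm F x̄` for the face `F ∋ x̄`. [cite: ZieschangVogtColdewey1980, 3.1.2] -/
theorem sysPerm_apply_of_bar_mem {Fs : List (List (ι × Bool))} (hd : Fs.flatten.Nodup)
    {F : List (ι × Bool)} (hF : F ∈ Fs) {x : ι × Bool} (hx : bar x ∈ F) :
    sysPerm Fs x = F.formPerm (bar x) := by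
  rw [sysPerm_apply, prod_formPerm_apply_of_mem hd hF hx]

/-- The vertex permutation preserves the letters of a closed system. [cite: ZieschangVogtColdewey1980, 3.1.2] -/
theorem sysPerm_apply_mem {Fs : List (List (ι × Bool))} (hd : Fs.flatten.Nodup)
    (hc : Closed Fs.flatten) {x : ι × Bool} (hx : x ∈ Fs.flatten) : sysPerm Fs x ∈ Fs.flatten := by
  obtain ⟨F, hF, hxF⟩ := mem_flatten.1 (hc x hx)
  rw [sysPerm_apply_of_bar_mem hd hF hxF]
  exact mem_flatten.2 ⟨F, hF, formPerm_apply_mem_of_mem hxF⟩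

/-- **The vertex permutation only depends on the set of faces** (pairwise distinct letters).
[cite: ZieschangVogtColdewey1980, 3.1.2] -/
theorem sysPerm_eq_of_perm {Fs Fs' : List (List (ι × Bool))} (hd : Fs.flatten.Nodup) (h : Fs ~ Fs') :
    sysPerm Fs = sysPerm Fs' := by
  have hd' : Fs'.flatten.Nodup := hd.perm h.flatten
  refine Equiv.ext fun x => ?_
  rw [sysPerm_apply, sysPerm_apply]
  by_cases hx : bar x ∈ Fs.flatten
  · obtain ⟨F, hF, hxF⟩ := mem_flatten.1 hx
    rw [prod_formPerm_apply_of_mem hd hF hxF, prod_formPerm_apply_of_mem hd' (h.mem_iff.1 hF) hxF]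
  · rw [prod_formPerm_apply_of_not_mem hx, prod_formPerm_apply_of_not_mem fun h' => hx ?_]
    exact h.symm.flatten.mem_iff.1 h'

/-- **The vertex permutation only depends on the cyclic faces**: rotating a face does not change
it. [cite: ZieschangVogtColdewey1980, 3.1.2] -/
theorem sysPerm_cons_eq_of_isRotated {F F' : List (ι × Bool)} (Gs : List (List (ι × Bool)))
    (hd : F.Nodup) (h : F ~r F') : sysPerm (F :: Gs) = sysPerm (F' :: Gs) := by
  simp only [sysPerm, map_cons, prod_cons, formPerm_eq_of_isRotated hd h]

/-! ### Concatenating two faces -/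

/-- A transposition of two fixed points of `R` commutes with `R`. [folklore] -/
private theorem swap_mul_eq_mul_swap_of_apply_eq {α : Type*} [DecidableEq α] {R : Perm α} {a b : α}
    (ha : R a = a) (hb : R b = b) : swap a b * R = R * swap a b := by
  refine Equiv.ext fun x => ?_
  rw [Perm.mul_apply, Perm.mul_apply]
  by_cases hxa : x = a
  · subst hxa; rw [ha, swap_apply_left, hb]
  by_cases hxb : x = b
  · subst hxb; rw [hb, swap_apply_right, ha]
  rw [swap_apply_of_ne_of_ne hxa hxb, swap_apply_of_ne_of_ne]
  · exact fun h => hxa (R.injective (h.trans ha.symm))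
  · exact fun h => hxb (R.injective (h.trans hb.symm))

/-- **Concatenating two faces** `Φ`, `r` of a system into one face `Φ ++ r` multiplies the vertex
permutation on the right by the transposition of the partners of the two last letters (the two
boundary cycles are joined at one corner; ZVC 3.1.6). [cite: ZieschangVogtColdewey1980, 3.1.6] -/
theorem sysPerm_append_cons {Φ r : List (ι × Bool)} {Gs : List (List (ι × Bool))}
    (hd : (Φ :: r :: Gs).flatten.Nodup) (hΦ : Φ ≠ []) (hr : r ≠ []) :
    sysPerm ((Φ ++ r) :: Gs) =
      sysPerm (Φ :: r :: Gs) * swap (bar (Φ.getLast hΦ)) (bar (r.getLast hr)) := by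
  have hdΦr : (Φ ++ r).Nodup := by
    have := hd; rw [flatten_cons, flatten_cons, ← append_assoc] at this
    exact (nodup_append.1 this).1
  have hΦl : Φ.getLast hΦ ∉ Gs.flatten := fun h => by
    rw [flatten_cons] at hd
    exact (disjoint_of_nodup_append hd) (getLast_mem hΦ) (by rw [flatten_cons]; exact mem_append_right _ h)
  have hrl : r.getLast hr ∉ Gs.flatten := fun h => by
    rw [flatten_cons, flatten_cons] at hd
    exact (disjoint_of_nodup_append (nodup_append.1 hd).2.1) (getLast_mem hr) h
  set R := (Gs.map List.formPerm).prod with hR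
  have hcomm : swap (Φ.getLast hΦ) (r.getLast hr) * R = R * swap (Φ.getLast hΦ) (r.getLast hr) :=
    swap_mul_eq_mul_swap_of_apply_eq (prod_formPerm_apply_of_not_mem hΦl)
      (prod_formPerm_apply_of_not_mem hrl)
  have hb1 : (barPerm : Perm (ι × Bool)) * barPerm = 1 := mul_eq_one_iff_eq_inv.2 barPerm_inv.symm
  have hbar : swap (Φ.getLast hΦ) (r.getLast hr) * (barPerm : Perm (ι × Bool)) =
      barPerm * swap (bar (Φ.getLast hΦ)) (bar (r.getLast hr)) := by
    have e : swap (bar (Φ.getLast hΦ)) (bar (r.getLast hr)) =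
        barPerm * swap (Φ.getLast hΦ) (r.getLast hr) * barPerm⁻¹ := by
      rw [← swap_apply_apply]; rfl
    rw [e, barPerm_inv, ← mul_assoc, ← mul_assoc, hb1, one_mul]
  have key : swap (Φ.getLast hΦ) (r.getLast hr) * (R * barPerm) =
      R * (barPerm * swap (bar (Φ.getLast hΦ)) (bar (r.getLast hr))) := by
    rw [← mul_assoc, hcomm, mul_assoc, hbar]
  simp only [sysPerm, map_cons, prod_cons, formPerm_append_eq Φ r hdΦr hΦ hr, ← hR, mul_assoc, key]

/-! ### Deleting letters: the first-return description -/

section Filter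

variable {α : Type*} [DecidableEq α]

/-- Powers of `formPerm l` preserve the letters of `l`. [folklore] -/
private theorem formPerm_pow_apply_mem {l : List α} {x : α} (hx : x ∈ l) (n : ℕ) :
    (l.formPerm ^ n) x ∈ l := by
  simpa using form_perm_zpow_apply_mem_imp_mem l x hx n

/-- **Deleting letters from a cyclic word is a first-return map**: if `x` is kept by the filter
`p`, its successor in `F.filter p` is the first later letter of `F` (cyclically) kept by `p`:
`formPerm (F.filter p) x = (formPerm F)^m x` with all intermediate `(formPerm F)^k x` (`0 < k < m`)
rejected by `p`. [cite: ZieschangVogtColdewey1980, 3.1.6 (b)] -/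
theorem exists_firstReturn_formPerm_filter {F : List α} (hd : F.Nodup) (p : α → Bool) {x : α}
    (hx : x ∈ F) (hpx : p x = true) :
    ∃ m, 1 ≤ m ∧ (F.filter p).formPerm x = (F.formPerm ^ m) x ∧
      ∀ k, 1 ≤ k → k < m → p ((F.formPerm ^ k) x) = false := by
  -- rotate `x` to the front
  obtain ⟨P, Q, rfl⟩ := append_of_mem hx
  set M := Q ++ P with hM
  have hrot : (P ++ x :: Q) ~r (x :: M) := by simpa [hM] using isRotated_append (l := P) (l' := x :: Q)
  have hd' : (x :: M).Nodup := hrot.perm.nodup_iff.1 hd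
  have hxM : x ∉ M := (nodup_cons.1 hd').1
  have hxP : x ∉ P := fun h => hxM (by simp [hM, h])
  have hxQ : x ∉ Q := fun h => hxM (by simp [hM, h])
  have hrotf : ((P ++ x :: Q).filter p) ~r (x :: M.filter p) := by
    have e1 : (P ++ x :: Q).filter p = P.filter p ++ (x :: Q.filter p) := by
      rw [filter_append, filter_cons_of_pos hpx]
    have e2 : x :: M.filter p = (x :: Q.filter p) ++ P.filter p := by
      rw [hM, filter_append, cons_append]
    rw [e1, e2]; exact isRotated_append
  rw [formPerm_eq_of_isRotated hd hrot, formPerm_eq_of_isRotated (hd.filter p) hrotf]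
  have hlen : (x :: M).length = M.length + 1 := rfl
  rcases hfil : M.filter p with _ | ⟨y, rest⟩
  · -- nothing else is kept: the successor of `x` is `x` itself, after a full turn
    refine ⟨M.length + 1, by omega, ?_, ?_⟩
    · rw [formPerm_singleton, Perm.one_apply, ← hlen, formPerm_pow_length_eq_one_of_nodup (x :: M) hd',
        Perm.one_apply]
    · intro k hk1 hk2
      rw [formPerm_pow_apply_head x M hd' k]
      have hk : k % (x :: M).length = k := Nat.mod_eq_of_lt (by rw [hlen]; exact hk2)
      simp only [hk]
      obtain ⟨k', rfl⟩ : ∃ k', k = k' + 1 := ⟨k - 1, by omega⟩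
      have hk' : k' < M.length := by omega
      have : (x :: M)[k' + 1]'(by rw [hlen]; omega) = M[k'] := getElem_cons_succ ..
      rw [this]
      have hmem : M[k'] ∈ M := getElem_mem hk'
      simpa using (filter_eq_nil_iff.1 hfil) _ hmem
  · -- the first kept letter `y` after `x`
    obtain ⟨M₁, M₂, hM12, hM₁, hpy, -⟩ := filter_eq_cons_iff.1 hfil
    refine ⟨M₁.length + 1, by omega, ?_, ?_⟩
    · have hdf : (x :: y :: rest).Nodup := by
        rw [← hfil]; exact (hd'.filter p : (filter p (x :: M)).Nodup) |> fun h => by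
          rw [filter_cons_of_pos hpx] at h; exact h
      rw [formPerm_apply_head x y rest hdf, formPerm_pow_apply_head x M hd']
      have hlt : M₁.length + 1 < (x :: M).length := by rw [hlen, hM12]; simp
      simp only [Nat.mod_eq_of_lt hlt]
      have : (x :: M)[M₁.length + 1]'hlt = M[M₁.length]'(by rw [hM12]; simp) := getElem_cons_succ ..
      rw [this]
      simp [hM12]
    · intro k hk1 hk2
      rw [formPerm_pow_apply_head x M hd' k]
      have hlt : k < (x :: M).length := by rw [hlen, hM12]; simp; omega
      simp only [Nat.mod_eq_of_lt hlt]
      obtain ⟨k', rfl⟩ : ∃ k', k = k' + 1 := ⟨k - 1, by omega⟩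
      have hk' : k' < M₁.length := by omega
      have e1 : (x :: M)[k' + 1]'hlt = M[k']'(by rw [hM12]; simp; omega) := getElem_cons_succ ..
      have e2 : M[k']'(by rw [hM12]; simp; omega) = M₁[k'] := by
        simp only [hM12]; exact getElem_append_left hk'
      rw [e1, e2]
      simpa using hM₁ _ (getElem_mem hk')

end Filter

omit [DecidableEq ι] in
/-- **The contraction involution** of a set `D` of letters closed under `bar`: `bar` on `D`,
the identity elsewhere. [cite: ZieschangVogtColdewey1980, 3.1.6 (b)] -/
def delPerm (D : ι × Bool → Bool) (hD : ∀ x, D (bar x) = D x) : Perm (ι × Bool) :=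
  Function.Involutive.toPerm (fun x => if D x = true then bar x else x) (by
    intro x
    by_cases h : D x = true
    · simp [h, hD]
    · simp [h])

omit [DecidableEq ι] in
/-- `delPerm` on a deleted letter. [cite: ZieschangVogtColdewey1980, 3.1.6 (b)] -/
theorem delPerm_apply_of_pos {D : ι × Bool → Bool} (hD : ∀ x, D (bar x) = D x) {x : ι × Bool}
    (h : D x = true) : delPerm D hD x = bar x := by
  simp [delPerm, h]

omit [DecidableEq ι] in
/-- `delPerm` on a kept letter. [cite: ZieschangVogtColdewey1980, 3.1.6 (b)] -/
theorem delPerm_apply_of_neg {D : ι × Bool → Bool} (hD : ∀ x, D (bar x) = D x) {x : ι × Bool}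
    (h : D x = false) : delPerm D hD x = x := by
  simp [delPerm, h]

/-- **Deleting a `bar`-closed set of letters from all faces**: on a kept letter `o`, the new
vertex permutation is the first return to the kept letters of `sysPerm Fs ∘ delPerm D` (the old
vertex permutation twisted by `bar` on the deleted letters — i.e. contracting the deleted edges).
[cite: ZieschangVogtColdewey1980, 3.1.6 (b)] -/
theorem sysPerm_filter_firstReturn {Fs : List (List (ι × Bool))} (hd : Fs.flatten.Nodup)
    (D : ι × Bool → Bool) (hD : ∀ x, D (bar x) = D x) {o : ι × Bool} (hoD : D o = false) :
    ∃ m, 1 ≤ m ∧ sysPerm (Fs.map fun F => F.filter fun x => !D x) o = ((sysPerm Fs * delPerm D hD) ^ m) o ∧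
      ∀ k, 1 ≤ k → k < m → D (((sysPerm Fs * delPerm D hD) ^ k) o) = true := by
  set Fs' := Fs.map fun F => F.filter fun x => !D x with hFs'
  have hd' : Fs'.flatten.Nodup := by
    rw [hFs', ← filter_flatten]; exact hd.filter _
  have h1 : (sysPerm Fs * delPerm D hD) o = sysPerm Fs o := by
    rw [Perm.mul_apply, delPerm_apply_of_neg hD hoD]
  have hoD' : D (bar o) = false := by rw [hD]; exact hoD
  by_cases ho : bar o ∈ Fs.flatten
  · obtain ⟨F, hF, hoF⟩ := mem_flatten.1 ho
    have hF' : (F.filter fun x => !D x) ∈ Fs' := mem_map.2 ⟨F, hF, rfl⟩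
    have hoF' : bar o ∈ F.filter fun x => !D x := mem_filter.2 ⟨hoF, by simp [hoD']⟩
    have hdF : F.Nodup := (nodup_flatten.1 hd).1 F hF
    obtain ⟨m, hm, hret, hmid⟩ := exists_firstReturn_formPerm_filter hdF (fun x => !D x) hoF (by simp [hoD'])
    -- the iterates of `σ ∘ delPerm` follow the face `F`
    have iter : ∀ k, 1 ≤ k → k ≤ m → ((sysPerm Fs * delPerm D hD) ^ k) o = (F.formPerm ^ k) (bar o) := by
      intro k hk1 hkm
      induction k with
      | zero => omega
      | succ k ih =>
        rcases Nat.eq_zero_or_pos k with rfl | hk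
        · rw [pow_one, pow_one, h1, sysPerm_apply_of_bar_mem hd hF hoF]
        · rw [pow_succ', Perm.mul_apply, ih hk (by omega), pow_succ', Perm.mul_apply, Perm.mul_apply]
          have hxD : D ((F.formPerm ^ k) (bar o)) = true := by
            simpa using hmid k hk (by omega)
          rw [delPerm_apply_of_pos hD hxD, sysPerm_apply_of_bar_mem hd hF]
          · rw [bar_bar]
          · rw [bar_bar]; exact formPerm_pow_apply_mem hoF k
    refine ⟨m, hm, ?_, fun k hk1 hk2 => ?_⟩
    · rw [sysPerm_apply_of_bar_mem hd' hF' hoF', hret, iter m hm le_rfl]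
    · rw [iter k hk1 hk2.le]; simpa using hmid k hk1 hk2
  · -- a letter outside the system: both permutations just apply `bar`
    refine ⟨1, le_rfl, ?_, fun k hk1 hk2 => by omega⟩
    have ho' : bar o ∉ Fs'.flatten := fun h => ho (by
      rw [hFs', ← filter_flatten] at h; exact mem_of_mem_filter h)
    rw [pow_one, h1, sysPerm_apply, sysPerm_apply, prod_formPerm_apply_of_not_mem ho,
      prod_formPerm_apply_of_not_mem ho']

/-- **Cycles after a deletion**: kept letters in one cycle of `sysPerm Fs ∘ delPerm D` are in one
cycle of the vertex permutation of the system with the `D`-letters deleted.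
[cite: ZieschangVogtColdewey1980, 3.1.6 (b)] -/
theorem sameCycle_sysPerm_filter [Fintype ι] {Fs : List (List (ι × Bool))} (hd : Fs.flatten.Nodup)
    (D : ι × Bool → Bool) (hD : ∀ x, D (bar x) = D x)
    {x z : ι × Bool} (hx : D x = false) (hz : D z = false)
    (h : (sysPerm Fs * delPerm D hD).SameCycle x z) :
    (sysPerm (Fs.map fun F => F.filter fun x => !D x)).SameCycle x z := by
  classical
  have key := fun o (ho : D o = false) => sysPerm_filter_firstReturn hd D hD ho
  choose m hm hret hmid using key
  let m' : ι × Bool → ℕ := fun o => if ho : D o = false then m o ho else 1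
  refine sameCycle_of_firstReturn (D := {w | D w = true}) m' ?_ ?_ ?_ ?_ (by simpa using hx)
    (by simpa using hz) h
  · intro o ho
    have ho' : D o = false := by simpa using ho
    simp only [m', ho', dif_pos]; exact hm o ho'
  · intro o ho
    have ho' : D o = false := by simpa using ho
    simp only [m', ho', dif_pos]; exact (hret o ho').symm
  · intro o ho k hk1 hk2
    have ho' : D o = false := by simpa using ho
    simp only [m', ho', dif_pos] at hk2
    exact hmid o ho' k hk1 hk2
  · intro o ho
    have ho' : D o = false := by simpa using ho
    simp only [Set.mem_setOf_eq, Bool.not_eq_true]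
    by_cases hbo : bar o ∈ (Fs.map fun F => F.filter fun x => !D x).flatten
    · obtain ⟨F', hF', hoF'⟩ := mem_flatten.1 hbo
      have hd' : (Fs.map fun F => F.filter fun x => !D x).flatten.Nodup := by
        rw [← filter_flatten]; exact hd.filter _
      rw [sysPerm_apply_of_bar_mem hd' hF' hoF']
      have hmem := formPerm_apply_mem_of_mem hoF'
      obtain ⟨F, -, rfl⟩ := mem_map.1 hF'
      simpa using (mem_filter.1 hmem).2
    · rw [sysPerm_apply, prod_formPerm_apply_of_not_mem hbo, hD]; exact ho'

/-! ### Gluing two faces along an edge -/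

/-- **Gluing two faces along a common edge does not change the vertices**: if the faces
`A ++ [y]` and `C ++ [ȳ]` of a closed system with one vertex are replaced by the single face
`A ++ C` (the edge `y` disappears), the vertex permutation stays transitive on the remaining
letters. [cite: ZieschangVogtColdewey1980, 3.1.5] -/
theorem sysPerm_glue_transitive [Fintype ι] {y : ι × Bool} {A C : List (ι × Bool)}
    {Gs : List (List (ι × Bool))} (hd : ((A ++ [y]) :: (C ++ [bar y]) :: Gs).flatten.Nodup)
    (h : ∀ x ∈ ((A ++ [y]) :: (C ++ [bar y]) :: Gs).flatten, ∀ z ∈ ((A ++ [y]) :: (C ++ [bar y]) :: Gs).flatten,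
      (sysPerm ((A ++ [y]) :: (C ++ [bar y]) :: Gs)).SameCycle x z) :
    ∀ x ∈ ((A ++ C) :: Gs).flatten, ∀ z ∈ ((A ++ C) :: Gs).flatten,
      (sysPerm ((A ++ C) :: Gs)).SameCycle x z := by
  classical
  -- concatenate the two faces
  have hd₁ : ((A ++ [y] ++ (C ++ [bar y])) :: Gs).flatten.Nodup := by
    simpa [flatten_cons, append_assoc] using hd
  have hconcat : sysPerm ((A ++ [y] ++ (C ++ [bar y])) :: Gs) =
      sysPerm ((A ++ [y]) :: (C ++ [bar y]) :: Gs) * swap (bar y) y := by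
    have := sysPerm_append_cons (Φ := A ++ [y]) (r := C ++ [bar y]) (Gs := Gs) hd (by simp) (by simp)
    rw [this]
    congr 2 <;> simp
  -- delete `y`, `ȳ`
  let D : ι × Bool → Bool := fun x => decide (x = y ∨ x = bar y)
  have hD : ∀ x, D (bar x) = D x := fun x => by
    by_cases h1 : x = y
    · subst h1; simp [D]
    · by_cases h2 : x = bar y
      · subst h2; simp [D]
      · have h3 : bar x ≠ y := fun e => h2 (by rw [← e, bar_bar])
        have h4 : bar x ≠ bar y := fun e => h1 (bar_injective e)
        simp [D, h1, h2, h3, h4]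
  have hdel : delPerm D hD = swap y (bar y) := by
    refine Equiv.ext fun x => ?_
    by_cases h1 : x = y
    · subst h1; rw [delPerm_apply_of_pos hD (by simp [D]), swap_apply_left]
    by_cases h2 : x = bar y
    · subst h2; rw [delPerm_apply_of_pos hD (by simp [D]), swap_apply_right, bar_bar]
    rw [delPerm_apply_of_neg hD (by simp [D, h1, h2]), swap_apply_of_ne_of_ne h1 h2]
  have hPi : sysPerm ((A ++ [y] ++ (C ++ [bar y])) :: Gs) * delPerm D hD =
      sysPerm ((A ++ [y]) :: (C ++ [bar y]) :: Gs) := by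
    rw [hconcat, hdel, mul_assoc, swap_comm (bar y) y, swap_mul_self, mul_one]
  -- `y`, `ȳ` occur only where displayed
  have hdΦr : (A ++ [y] ++ (C ++ [bar y])).Nodup := (nodup_append.1 hd₁).1
  have hyA : y ∉ A := fun h' =>
    (disjoint_of_nodup_append (nodup_append.1 hdΦr).1) h' (mem_singleton_self _)
  have hyA' : bar y ∉ A := fun h' => (disjoint_of_nodup_append hdΦr) (mem_append_left _ h') (by simp)
  have hyC : y ∉ C := fun h' => (disjoint_of_nodup_append hdΦr) (by simp) (mem_append_left _ h')
  have hyC' : bar y ∉ C := fun h' =>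
    (disjoint_of_nodup_append (nodup_append.1 hdΦr).2.1) h' (mem_singleton_self _)
  have hyG : ∀ G ∈ Gs, y ∉ G ∧ bar y ∉ G := by
    intro G hG
    have hdis := disjoint_of_nodup_append hd₁
    exact ⟨fun h' => hdis (by simp) (mem_flatten.2 ⟨G, hG, h'⟩),
      fun h' => hdis (by simp) (mem_flatten.2 ⟨G, hG, h'⟩)⟩
  have keep : ∀ L : List (ι × Bool), y ∉ L → bar y ∉ L → L.filter (fun x => !D x) = L := by
    intro L h1 h2
    rw [filter_eq_self]
    intro x hx
    have hx1 : x ≠ y := fun e => h1 (e ▸ hx)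
    have hx2 : x ≠ bar y := fun e => h2 (e ▸ hx)
    simp [D, hx1, hx2]
  have hfilt : ((A ++ [y] ++ (C ++ [bar y])) :: Gs).map (fun F => F.filter fun x => !D x) = (A ++ C) :: Gs := by
    rw [map_cons]
    congr 1
    · rw [filter_append, filter_append, filter_append, keep A hyA hyA', keep C hyC hyC']
      simp [D]
    · rw [map_congr_left fun G hG => keep G (hyG G hG).1 (hyG G hG).2, map_id']
  have hnot : y ∉ ((A ++ C) :: Gs).flatten ∧ bar y ∉ ((A ++ C) :: Gs).flatten := by
    constructor
    · intro h'
      simp only [flatten_cons, mem_append] at h'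
      rcases h' with (h' | h') | h'
      · exact hyA h'
      · exact hyC h'
      · obtain ⟨G, hG, h''⟩ := mem_flatten.1 h'; exact (hyG G hG).1 h''
    · intro h'
      simp only [flatten_cons, mem_append] at h'
      rcases h' with (h' | h') | h'
      · exact hyA' h'
      · exact hyC' h'
      · obtain ⟨G, hG, h''⟩ := mem_flatten.1 h'; exact (hyG G hG).2 h''
  have hsub : ∀ x ∈ ((A ++ C) :: Gs).flatten, x ∈ ((A ++ [y]) :: (C ++ [bar y]) :: Gs).flatten := by
    intro x hx
    simp only [flatten_cons, mem_append] at hx ⊢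
    rcases hx with (hx | hx) | hx
    · exact Or.inl (Or.inl hx)
    · exact Or.inr (Or.inl (Or.inl hx))
    · exact Or.inr (Or.inr hx)
  have hDfalse : ∀ x ∈ ((A ++ C) :: Gs).flatten, D x = false := by
    intro x hx
    have hx1 : x ≠ y := fun e => hnot.1 (e ▸ hx)
    have hx2 : x ≠ bar y := fun e => hnot.2 (e ▸ hx)
    simp [D, hx1, hx2]
  -- transfer the cycles
  intro x hx z hz
  rw [← hfilt]
  exact sameCycle_sysPerm_filter hd₁ D hD (hDfalse x hx) (hDfalse z hz)
    (by rw [hPi]; exact h x (hsub x hx) z (hsub z hz))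

end Literature.GroupTheory.CombinatorialGroupTheory
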